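/-
Origin: expansion seat `planner-pub-hodgecm-toy-g5-0`, handover #1 2026-08-18T13:55:58Z (md5 99fa22f2) (`HOME/pub-hodgecm-toy-g5/lean/ToyG5/HodgeRiemann3.lean`, md5 99fa22f2, 146 lines);
landed by the gen-8 packager in gate run 30 as `HodgeCM/Model/ToyG2/HodgeRiemann3.lean` (verbatim).
-/
/-
Copyright (c) 2026. All rights reserved.
Released under Apache 2.0 license as described in the file LICENSE.
-/
import Mathlib
import Summits.HodgeConjecture.HodgeCM.Model.ToyG2.ThetaGram_4
import Summits.HodgeConjecture.HodgeCM.Model.ToyG2.SplitAllGood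
import Summits.HodgeConjecture.HodgeCM.Model.Inhabited
import Summits.HodgeConjecture.HodgeCM.Proofs.Landherr
import Summits.HodgeConjecture.HodgeCM.Proofs.RealisationConstruction
import Summits.HodgeConjecture.HodgeCM.Automorphic.ThetaFacts

/-!
# HodgeCM.Model.ToyG2.HodgeRiemann3 — Hodge–Riemann `(2,0)` FAILS in the universe of record `toyUniverse₃ d t`

pub-hodgecm cell, seat `planner-pub-hodgecm-toy-g5-0` (EXPANSION part (e), CONSISTENCY WITNESS, generation 5),
2026-08-18.  Intended tree location `HodgeCM/Model/ToyG2/HodgeRiemann3.lean`.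

The class-P binder `Universe.Fact_hodgeRiemann20` (`HodgeCM.Automorphic.ThetaFacts`; the hypothesis `hHR` of the
end state of record `Assembly.COR_CM_endState` and of every theta-model route, consumed only through
`RealisationConstruction.emb_ne_zero`) asks that on every surface `X` a nonzero class `η ∈ F²H²(X)` has
`tr_ℂ(η ∪ η̄) ≠ 0`.  For the universe of record `toyUniverse₃ d t` (`HodgeCM.Model.ToyG2.Universe3`; 28/28 model
axioms for ALL `d t`, `SplitAllGood.toyUniverse₃_modelAxioms_all`) this is FALSE, for every choice of the
parameters, and for two independent reasons.

* §1 **Cross-block classes** (all `d t`).  The period surface at `(L, ι₁)` is the block object on the period leaf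
  `P(L, ι₁) = ∏_{q ∈ Q(L,ι₁)} M_{Θ_q}` whose degree-4 trace is the SUM of the block functionals
  `ℓ = ∑_q ℓ_{Θ_q} ∘ ⋀⁴ pr_q` (`PeriodLeaf.pLeafOf`).  As soon as `Q(L, ι₁)` has two elements `q₁ ≠ q₂` — it does
  for the face field `F = ℚ(ζ₇)` of `faceHypothesesInhabited`: the face quadruple `f.psi` and the constant quadruple
  on `f.psi 0` — the class `η = E_{q₁,0,θ} ∪ E_{q₂,0,θ}` (`θ = ι₁` transported; pv03-g5's single eigenvectors
  `ThetaUiso.eCls`) is a nonzero `(2,0)`-class (`eCls_mem_H10₃`, `cup2C_mem_F2`, `cup_eCls_ne_zero₃`) with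
  `tr_ℂ(η ∪ η̄) = period(E₁, E₂, E₁, E₂) = 0` by the MIXED-BLOCK vanishing `ThetaUiso.period_eCls_mixed₃`.
  Hence `not_toyUniverse₃_hodgeRiemann20 : ∀ d t, ¬ (toyUniverse₃ d t).Fact_hodgeRiemann20`.

* §2 **The kernel of the Gram map inside ONE block** (`1 ≤ d`, `t² = 16`, the parameters of the theta realisation
  of record `ThetaModel3`; proved in the COMPANION LEAF `HodgeCM.Model.ToyG2.HodgeRiemannKernel3` of the same seat,
  handed separately — recorded here because it is the diagnosis that matters for a repair).  For ANY `(L, ι₁)`, any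
  block `q` and `θ = ι₁`: the realisation's Gram identity `ThetaGram.inner_Λ₃`
  (`⟪Λ(ω₂,ω₃), Λ(ω₀,ω₁)⟫ = ¼ · period(ω₀,ω₁,ω₂,ω₃)`) and its KERNEL RELATION
  `Λ(E_{q,0,θ}, E_{q,1,θ}) = κ • Λ(E_{q,2,θ}, E_{q,3,θ})` (`ThetaGram.Λ_theta01_eq_smul`, the input of
  `gen12`/`real34` in `ThetaModel3`) make the nonzero `(2,0)`-class `η = E_{q,0,θ} ∪ E_{q,1,θ} − κ • E_{q,2,θ} ∪ E_{q,3,θ}`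
  ISOTROPIC: `tr_ℂ(η ∪ η̄) = 4 ‖Λ(E₀,E₁) − κ Λ(E₂,E₃)‖² = 0`.  This is the precise sense in which the realisation of
  record is incompatible with HR20 even on a single block (e.g. `L` imaginary quadratic, where §1 is void): its
  Matsushima map has a kernel on `F²H²(P_Γ)`, which is what `Fact_hodgeRiemann20 ∧ Fact_innerEmb` forbid
  (`RealisationConstruction.emb_ne_zero`).

Consequence for G4 (consistency of the end state of record): the hypotheses of `Assembly.COR_CM_endState` are NOT
jointly witnessed by `toyUniverse₃ d t`; a witness needs a universe whose surfaces have (i) block-ADDITIVE cohomology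
(no cross-block classes: `H^•(∐_q M_q) = ⊕_q H^•(M_q)`, not `⋀^•(⊕_q H¹(M_q))`) and (ii) an `H²` in which the kernel
of the Hodge–Riemann form on `⋀² H^{1,0}` is divided out (so that the kernel relation holds IN COHOMOLOGY, as it does
for genuine theta lifts), i.e. `H²(P) ≠ ⋀² H¹(P)`.  Recorded for the successor in `HOME/pub-hodgecm-toy-g5/TOY-G5.md`.

Everything is kernel-proved from the tree (toy-g2 `PeriodLeaf`/`Universe3`, toy-g3 `SplitAllGood`, pv03-g5
`ThetaUiso`/`ThetaPeriod`/`ThetaGram`, `Model.Inhabited`, `Proofs.Landherr`, `Proofs.RealisationConstruction`);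
nothing cited, nothing posited, no unfinished proofs.
-/

open scoped TensorProduct InnerProductSpace
open HodgeCM.Toy HodgeCM.Toy.CMPresentation exteriorPower NumberField.ComplexEmbedding
open Literature.AlgebraicGeometry.Motives
open Literature.AlgebraicGeometry.Motives.HodgeStructure (conj)

namespace HodgeCM.ToyG2

open ThetaUiso

noncomputable section

/-! ### §1 Cross-block classes: `¬ Fact_hodgeRiemann20` for all `d t` -/

section CrossBlock

variable (d t : ℚ) {L : CMField} (ι₁ : L →+* ℂ) {V : HermSpace3 L ι₁} (Γ : Level V)

/-- the transported embedding `θ = ι₁ ∘ eK⁻¹` is holomorphic for every slot of every block of `P(L, ι₁)` -/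
theorem hr3_embOf_hol (k : Fin (nQ L ι₁)) (i : Fin 4) :
    (embOf L ι₁).comp (eK L : L →+* FK L) ∈ (ΘOf L ι₁ k i).1 := by
  rw [embOf_comp]
  exact mem_ΘOf L ι₁ k i

/-- the single eigenvector `E_{k,i,ι₁}` is a `(1,0)`-class of the period surface -/
theorem hr3_eCls_mem_H10 (k : Fin (nQ L ι₁)) (i : Fin 4) :
    eCls ι₁ d t k i (embOf L ι₁) ∈ (toyUniverse₃ d t).H10 ((toyUniverse₃ d t).pms L ι₁ V Γ) :=
  eCls_mem_H10₃ d t ι₁ Γ k i (hr3_embOf_hol ι₁ k i)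

/-- **Two distinct blocks refute HR20.**  If the period leaf `P(L, ι₁)` has two blocks `k₁ ≠ k₂`, the class
`η = E_{k₁,0,ι₁} ∪ E_{k₂,0,ι₁} ∈ F²H²(P_Γ)` is nonzero and `tr_ℂ(η ∪ η̄) = 0`. -/
theorem hr3_crossBlock {k₁ k₂ : Fin (nQ L ι₁)} (hk : k₁ ≠ k₂) :
    ∃ η : (toyUniverse₃ d t).CohC ((toyUniverse₃ d t).pms L ι₁ V Γ) 2,
      η ∈ ((toyUniverse₃ d t).hodge ((toyUniverse₃ d t).pms L ι₁ V Γ) 2).F 2 ∧ η ≠ 0 ∧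
      (toyUniverse₃ d t).trC ((toyUniverse₃ d t).pms L ι₁ V Γ) 4
        ((toyUniverse₃ d t).cup2C ((toyUniverse₃ d t).pms L ι₁ V Γ) 2 η (conj η)) = 0 := by
  refine ⟨(toyUniverse₃ d t).cup2C ((toyUniverse₃ d t).pms L ι₁ V Γ) 1 (eCls ι₁ d t k₁ 0 (embOf L ι₁)) (eCls ι₁ d t k₂ 0 (embOf L ι₁)),
    ?_, ?_, ?_⟩
  · exact Universe.cup2C_mem_F2 (toyUniverse₃_modelAxioms_all d t) ((toyUniverse₃ d t).pms L ι₁ V Γ)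
      (hr3_eCls_mem_H10 d t ι₁ Γ k₁ 0) (hr3_eCls_mem_H10 d t ι₁ Γ k₂ 0)
  · exact cup_eCls_ne_zero₃ d t ι₁ Γ (Or.inl hk)
  · -- `tr_ℂ(η ∪ η̄) = period(E₁, E₂, E₁, E₂)` (`conj (a ∪ b) = ā ∪ b̄`), and the period of a family meeting two
    -- distinct blocks vanishes
    have h := period_eCls_mixed₃ d t ι₁ Γ ![k₁, k₂, k₁, k₂] (fun _ => (0 : Fin 4)) (fun _ => embOf L ι₁)
      (a := 0) (b := 1) (by simpa using hk)
    have hp : (toyUniverse₃ d t).trC ((toyUniverse₃ d t).pms L ι₁ V Γ) 4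
        ((toyUniverse₃ d t).cup2C ((toyUniverse₃ d t).pms L ι₁ V Γ) 2
          ((toyUniverse₃ d t).cup2C ((toyUniverse₃ d t).pms L ι₁ V Γ) 1 (eCls ι₁ d t k₁ 0 (embOf L ι₁)) (eCls ι₁ d t k₂ 0 (embOf L ι₁)))
          ((toyUniverse₃ d t).cup2C ((toyUniverse₃ d t).pms L ι₁ V Γ) 1 (conj (eCls ι₁ d t k₁ 0 (embOf L ι₁)))
            (conj (eCls ι₁ d t k₂ 0 (embOf L ι₁))))) = 0 := h
    rw [← Universe.conj_cup2C] at hp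
    exact hp

end CrossBlock

/-- the constant quadruple on a CM type containing `ι₁` is an admissible index of `P(L, ι₁)` -/
def hr3_qConst {L : CMField} (ι₁ : L →+* ℂ) (Φ : CMType L) (hΦ : ι₁ ∈ Φ.1) : QIdx L ι₁ :=
  ⟨fun _ => Φ, fun _ => rfl, fun _ => hΦ⟩

/-- **the face field `ℚ(ζ₇)` has two distinct admissible quadruples at its admissible embedding**: the face
quadruple `f.psi` (pair-sum, injective, all containing `ι₁`) and the constant quadruple on `f.psi 0` -/
theorem hr3_exists_two_blocks :
    ∃ (F : CMField) (ι₁ : F →+* ℂ) (k₁ k₂ : Fin (nQ F ι₁)), k₁ ≠ k₂ := by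
  obtain ⟨F, -, -, f, ι₁, hadm⟩ := faceHypothesesInhabited
  let q₁ : QIdx F ι₁ := ⟨f.psi, pairSum_psi f, admissible_mem_psi f ι₁ hadm⟩
  let q₂ : QIdx F ι₁ := hr3_qConst ι₁ (f.psi 0) (admissible_mem_psi f ι₁ hadm 0)
  have hq : q₁ ≠ q₂ := by
    intro h
    have h1 : f.psi 1 = f.psi 0 := congrArg (fun q : QIdx F ι₁ => q.1 1) h
    exact absurd (StubTree.psi_injective F f h1) (by decide)
  exact ⟨F, ι₁, eQ F ι₁ q₁, eQ F ι₁ q₂, fun h => hq ((eQ F ι₁).injective h)⟩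

/-- **Hodge–Riemann `(2,0)` FAILS in the universe of record, for all parameters `d t`.** -/
theorem not_toyUniverse₃_hodgeRiemann20 (d t : ℚ) : ¬ (toyUniverse₃ d t).Fact_hodgeRiemann20 := by
  intro hHR
  obtain ⟨F, ι₁, k₁, k₂, hk⟩ := hr3_exists_two_blocks
  obtain ⟨V⟩ := landherr_exists_proof F ι₁
  obtain ⟨Γ⟩ := Level.nonempty V
  obtain ⟨η, hF2, hne, h0⟩ := hr3_crossBlock d t ι₁ Γ hk
  exact hHR _ ((toyUniverse₃_modelAxioms_all d t).pms_dim F ι₁ V Γ) η hF2 hne h0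

/-- hence the universe of record does NOT witness the hypotheses of the end state of record jointly:
no theta model `T` over it has `ModelAxioms ∧ T.Inputs ∧ Fact_hodgeRiemann20` -/
theorem not_toyUniverse₃_inputs_and_hodgeRiemann20 (d t : ℚ) (T : (toyUniverse₃ d t).ThetaModel) :
    ¬ ((toyUniverse₃ d t).ModelAxioms ∧ T.Inputs ∧ (toyUniverse₃ d t).Fact_hodgeRiemann20) :=
  fun h => not_toyUniverse₃_hodgeRiemann20 d t h.2.2

end

end HodgeCM.ToyG2
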